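import Literature.NumberTheory.ConnesConsani2021.VanishingIdealReduction
import Literature.NumberTheory.ConnesConsani2021.KernelApproximation
import Literature.NumberTheory.ConnesConsani2021.RankOnePositivity
import HarnessLib

/-!
# Connes–Consani 2021, Remark 3.7 and eq. (Qprime)/(Eprime): the derivative-jump formula
# `Φ₊(Q₊ f) = −2φ′(0⁺) f(0) + ∫₀^∞ (f(x) + f(−x)) (Q₊φ)(x) dx`, and the quadratic form of
# Proposition 5.5, `⟨ξ|N_I(ξ)⟩ = E₊(Q₊(ξ^* ∗ ξ))`, `N_I = −2ε′(1₊)(1 − 𝐊_I)` — PROVED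

A. Connes, C. Consani, *Weil positivity and trace formula, the archimedean place*, Selecta Math.
(N.S.) 27 (2021), Paper No. 77 = arXiv:2006.13771 [bib: `ConnesConsani2021`]; §3 Theorem 3.6
(= Thm. 17 of the arXiv text, p. 13) with its eq. (Qprime), Remark 3.7 (= Rem. 18, pp. 13–14: "Since
the equality (Qprime) plays a key role in the sequel we give an elementary proof without appealing to
distribution theory"), §5 eq. (Eprime) (p. 20) and Proposition 5.5 (= Prop. 32, p. 20, proof p. 21),
as used in the proof of Theorem 6.11 (= Thm. 44, §6.7 p. 29: "Let `ξ(x) := k(exp(x))`.  One has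
`ξ ∈ 𝓗 = L²([−½ log 2, ½ log 2])` and using (quadform) of Proposition 5.5,
`E∘Q(k ∗ k*) = E₊(Q₊(ξ ∗ ξ*)) = ⟨ξ|N_I(ξ)⟩`").

**What is printed.**  *Remark 3.7*: "Let `k(x)` be an even function on `ℝ` whose restriction to
`[0,∞)` is a smooth function, then for any `f ∈ C_c^∞(ℝ)` one has
`∫_ℝ f″(x)k(x)dx = … = −f′(0)k(0) + f(0)k′(0⁺) + ∫₀^∞ f(x)k″(x)dx` [on `(0, ∞)`] and similarly
`∫_{−∞}^0 f″(x)k(x)dx = f′(0)k(0) − f(0)k′(0⁻) + ∫₀^∞ f(−x)k″(x)dx`.  Thus in the global sum the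
boundary terms `−f′(0)k(0)` and `f′(0)k(0)` cancel out but the boundary terms `f(0)k′(0⁺)` and
`−f(0)k′(0⁻)` do not … since `k` is even, `k′(0⁻) = −k′(0⁺)`.  Letting then `k(x) := δ(exp|x|)` one
obtains (Qprime)": with `Q₊ := −∂ₓ² + ¼` and `D₊(f) := ∫ f(x) δ(exp|x|) dx`,
`D₊(Q₊f) = −2f(0) + ∫₀^∞ (f(x) + f(−x)) Q₊δ(exp x) dx` (p. 13; `δ′(1⁺) = 1`).  *Eq. (Eprime)*
(p. 20): "As in (Qprime) we get, for the linear form `E₊(f) := ∫ f(x) ε(exp|x|) dx`, `f ∈ C_c^∞(ℝ)`, the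
expression `E₊(Q₊f) = −2ε′(1₊)f(0) + ∫₀^∞ (f(x) + f(−x))(Qε)(exp x) dx`."  *Proposition 5.5*: "Let
`I ⊂ [−log 2, log 2]` be an interval of length `≤ log 2`.  (i) The following equality defines a
bounded operator `N_I` in the Hilbert space `L²(I, dx)`: `⟨ξ|N_I(ξ)⟩ = E₊(Q₊f)`, `f = ξ^* ∗ ξ`,
`f(v) = ∫ ξ(x) ξ̄(x+v) dx`.  (ii) One has `N_I = −2ε′(1₊)(1 − 𝐊_I)`, where `𝐊_I` is the compact
operator defined by (opkf) `⟨ξ|𝐊_I(ξ)⟩ = (2ε′(1₊))⁻¹ ∫_{−log 2}^{log 2} ∫ ξ(x) ξ̄(x+v) (Qε)(exp|v|) dx dv`.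
*Proof.* … (ii) By applying (Eprime) to `f(v) = ∫ ξ(x) ξ̄(x+v) dx` one obtains
`⟨ξ|N_I(ξ)⟩ = −2ε′(1₊)⟨ξ|ξ⟩ + ∫₀^∞ (f(x) + f(−x))(Qε)(exp x) dx`.  Since the length of `I` is
`≤ log 2`, the function `f(v)` vanishes outside `[−log 2, log 2]` and thus we obtain (opkf)."
(§6.3 p. 24: `ϖ(x) := (Qε)(exp|x|)/(2ε′(1₊))`.)

**What is PROVED here**, following the printed computation literally, GENERIC in the even function:
we write `k(x) = φ(exp|x|) = G(|x|)` with `G : ℝ → ℂ` of class `C²` (the restriction of `k` to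
`[0, ∞)`; any `C²` function on `[0, ∞)` is the restriction of a `C²` function on `ℝ`, and only two
derivatives of `k` enter), so that `k′(0⁺) = G′(0)` (`hasDerivWithinAt_comp_abs`) and `k″ = G″`,
`Q₊k = opQ G` on `(0, ∞)` (`opQ h = −h″ + h/4` is the tree's additive form of CC's
`Q = −(ρ∂_ρ)² + ¼`, `Literature.NumberTheory.ConnesConsani2021.opQ`):

* `integral_Ioi_deriv_deriv_mul` — the one-sided computation of Remark 3.7,
  `∫₀^∞ f″ G = −f′(0)G(0) + f(0)G′(0) + ∫₀^∞ f G″` (two integrations by parts);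
* `integral_deriv_deriv_mul_comp_abs` — **Remark 3.7**:
  `∫_ℝ f″(x) G(|x|) dx = 2f(0)G′(0) + ∫₀^∞ (f(x)+f(−x)) G″(x) dx`;
* `evenFunctional G f = ∫ f(x) G(|x|) dx` (CC's `D₊` for `G = δ∘exp`, `E₊` for `G = ε∘exp`) and
  **(Qprime)/(Eprime)**: `evenFunctional G (Q₊f) = −2G′(0)f(0) + ∫₀^∞ (f(x)+f(−x)) (opQ G)(x) dx` —
  `evenFunctional_opQ`;
* **the proof of Prop. 5.5 (ii)** for `f = k ∗ k*` (`k ∈ C_c^∞`, the tree's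
  `weilConv k (weilReflect k)`, `f(0) = ‖k‖₂²`): the display
  `E₊(Q₊f) = −2G′(0)‖k‖² + ∫₀^∞ (f(x)+f(−x))(opQ G)(x) dx` — `evenFunctional_opQ_autocorr` — and,
  when `supp k ⊆ I = [a, b]` so that `f` vanishes outside `[a − b, b − a]` ("thus we obtain (opkf)"),
  `E₊(Q₊f) = −2G′(0)‖ξ‖² + ∫_{a−b}^{b−a} ∫ ξ(x) ξ̄(x+v) (opQ G)(|v|) dx dv` for the vector `ξ = k ∈ L²(I)`
  (`testVector`; CC: "`ξ(x) := k(exp x)`, `ξ ∈ 𝓗 = L²(I)`"), the double integral being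
  `KernelApproximation`'s `windowForm` — `evenFunctional_opQ_autocorr_eq_windowForm`;
* **Prop. 5.5 (i)+(ii) as used on p. 29**: with `ϖ_G(v) := (opQ G)(|v|)/(2G′(0))` (`varpi`; CC's `ϖ`
  for `G = ε∘exp`, `G′(0) = ε′(1₊)`) and `N := −2G′(0)(1 − windowOp ϖ_G)` (`opN`; CC's `N_I`, with
  `𝐊_I = windowOp ϖ` the bounded operator of (opkf) constructed in `KernelApproximation.lean`),
  `E₊(Q₊(k ∗ k*)) = ⟨ξ | N ξ⟩` — `evenFunctional_opQ_autocorr_eq_inner_opN`, and in the vector form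
  `⟨ξ | (−2G′(0)) • (ξ − 𝐊_I ξ)⟩` fed to `RankOnePositivity.re_inner_scaled_le_of_rankOne_decomposition`
  — `evenFunctional_opQ_autocorr_eq_inner`;
* **Theorem 3.6's shape** when `G′(0) = 1` (`δ`: `δ(exp|x|) = δ(1) + |x| + O(x²)`, p. 13):
  `D₊(Q₊(k ∗ k*)) = −2‖ξ‖² + ⟨ξ | K_I ξ⟩` — `evenFunctional_opQ_autocorr_eq_inner_of_deriv_eq_one`;
* CC's `η₀` ("the constant function normalized to be of norm 1", §6.7 p. 28) — `constVector`,
  `norm_constVector` — and the step "using `⟨η₀|ξ⟩ = (log 2)^{-1/2} k̂(0)`" of p. 29: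
  `⟨η₀|ξ⟩ = (b − a)^{-1/2} k̂(0)`, `|⟨η₀|ξ⟩|² = (b − a)⁻¹|k̂(0)|²` — `inner_constVector_testVector`,
  `norm_inner_constVector_testVector_sq`;
* **the chain of p. 29 assembled** with Lemma 6.10's deduction (`RankOnePositivity.lean`): under the
  §6.7 spectral hypotheses on a finite-rank `T` and `‖windowOp ϖ_G − T‖ ≤ ε₁ ≤ ε₂` (all hypotheses;
  in print they are the floating-point data of §6), `Re E₊(Q₊(k ∗ k*)) ≤ (2a₀e′/(b − a)) |k̂(0)|²`,
  i.e. "`E∘Q(k ∗ k*) = ⟨ξ|N_I(ξ)⟩ ≤ γ|⟨η₀|ξ⟩|² = (γ/log 2)|k̂(0)|²`" — `re_evenFunctional_opQ_autocorr_le`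
  (with `k̂(0) = −2ĝ(0)` of `VanishingIdealReduction.thm611_constant_eq`: the constant `c = 4γ/log 2`).

Not typed here (they are the inputs specific to CC's functions, not the mechanism): the functions
`δ` (§2, via `Si`) and `ε` (§4–5, the prolate series (sonine0)) themselves, their regularity on
`[1, ∞)` and the values `δ′(1⁺) = 1`, `ε′(1₊) ≃ 22.9965` (Lemma 5.4); compactness of `𝐊_I`
(Hilbert–Schmidt; not used on the path to Thm. 6.11); the length restriction `|I| ≤ log 2` is replaced by
integrating the kernel over `[a − b, b − a] ⊇ supp f` (for CC's `I = [−½ log 2, ½ log 2]` this is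
literally `[−log 2, log 2]`).  With `VanishingIdealReduction.lean` (Lemma 3.1, `Q(k ∗ k*) = g ∗ g*`),
`KernelApproximation.lean` (Lemma 6.3, `windowOp`) and `RankOnePositivity.lean` (Lemma 6.9/6.10), this
leaves of the printed proof of Theorem 1 / Theorem 6.11 exactly Theorem 4.7 (`Tr(ϑ(f)𝐒) = W_∞(f) + E(f)`),
the prolate description and regularity of `ε` with the value `ε′(1₊)` (§4–5), and the floating-point
inputs of §6 (cell `pub-rhdoor`, `HOME/lit/CC2021-RIGOUR-MAP.md` §1 items 3, 6).  No RH claim; no named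
fact is introduced.
-/

noncomputable section

open MeasureTheory Set Complex Filter
open scoped ComplexConjugate InnerProductSpace Topology

namespace Literature.NumberTheory.ConnesConsani2021

open Literature.NumberTheory.LFunctions

variable {F G H k : ℝ → ℂ} {a b : ℝ}

/-! ## Regularity bookkeeping -/

/-- `1 ≤ 2` in the smoothness exponents. [folklore] -/
private theorem one_le_two' : (1 : WithTop ℕ∞) ≤ 2 := by norm_num

/-- `2 ≠ 0` in the smoothness exponents. [folklore] -/
private theorem two_ne_zero'' : (2 : WithTop ℕ∞) ≠ 0 := by norm_num

/-- For a `C²` function, `f′` is `C¹`. [folklore] -/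
private theorem contDiff_one_deriv (hF : ContDiff ℝ 2 F) : ContDiff ℝ 1 (deriv F) := by
  rw [← one_add_one_eq_two] at hF
  exact hF.deriv'

/-- For a `C²` function, `f″` is continuous. [folklore] -/
private theorem continuous_deriv_deriv (hF : ContDiff ℝ 2 F) : Continuous (deriv (deriv F)) :=
  (contDiff_one_deriv hF).continuous_deriv le_rfl

/-- A test function (`C_c^∞`) is `C²`. [folklore] -/
private theorem contDiff_two_of_isWeilTest (hF : IsWeilTest F) : ContDiff ℝ 2 F :=
  hF.1.of_le (WithTop.coe_le_coe.2 le_top)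

/-- `Q₊G = −G″ + G/4` is continuous for `G ∈ C²`. [folklore] -/
private theorem continuous_opQ (hG : ContDiff ℝ 2 G) : Continuous (opQ G) := by
  have h1 : Continuous (deriv (deriv G)) := continuous_deriv_deriv hG
  show Continuous fun t ↦ -deriv (deriv G) t + (1 / 4 : ℂ) * G t
  exact h1.neg.add (continuous_const.mul hG.continuous)

/-- A test function is in `L²`. [folklore] -/
private theorem memLp_two_of_isWeilTest (hk : IsWeilTest k) : MemLp k 2 volume :=
  hk.1.continuous.memLp_of_hasCompactSupport hk.2

/-- `k′(0⁺) = G′(0)` for `k(x) = G(|x|)`: the right derivative at `0` of the even function is the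
derivative of its smooth branch (Remark 3.7: "`k′(0⁺) := lim_{ε→0⁺} (k(ε) − k(0))/ε`").
[cite: ConnesConsani2021, Rem. 3.7 §3 p. 14] -/
theorem hasDerivWithinAt_comp_abs (hG : DifferentiableAt ℝ G 0) :
    HasDerivWithinAt (fun x : ℝ ↦ G |x|) (deriv G 0) (Ici 0) 0 := by
  refine (hG.hasDerivAt.hasDerivWithinAt (s := Ici 0)).congr (fun x hx ↦ ?_) (by simp)
  rw [abs_of_nonneg (mem_Ici.1 hx)]

/-! ## The even regrouping `∫_ℝ h(x) G(|x|) dx = ∫₀^∞ (h(x) + h(−x)) G(x) dx` -/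

/-- `∫_ℝ h(x) G(|x|) dx = ∫₀^∞ (h(x) + h(−x)) G(x) dx` for continuous `h` of compact support and
continuous `G` (the regrouping behind "`∫₀^∞ (f(x) + f(−x)) …`" in (Qprime)/(Eprime)).
[cite: ConnesConsani2021, eq. (Qprime) §3 p. 13] -/
theorem integral_mul_comp_abs_eq_Ioi (hH : Continuous H) (hHs : HasCompactSupport H)
    (hG : Continuous G) :
    ∫ x, H x * G |x| = ∫ x in Ioi 0, (H x + H (-x)) * G x := by
  have hGa : Continuous fun x : ℝ ↦ G |x| := hG.comp continuous_abs
  have hint : Integrable (fun x ↦ H x * G |x|) :=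
    (hH.mul hGa).integrable_of_hasCompactSupport (hHs.mul_right (f' := fun x ↦ G |x|))
  have hHns : HasCompactSupport fun x : ℝ ↦ H (-x) := hHs.comp_homeomorph (Homeomorph.neg ℝ)
  have hint' : Integrable (fun x ↦ H (-x) * G |x|) :=
    ((hH.comp continuous_neg).mul hGa).integrable_of_hasCompactSupport
      (hHns.mul_right (f' := fun x ↦ G |x|))
  rw [← intervalIntegral.integral_Iic_add_Ioi hint.integrableOn hint.integrableOn]
  have h1 : ∫ x in Iic (0 : ℝ), H x * G |x| = ∫ x in Ioi (0 : ℝ), H (-x) * G |x| := by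
    have h := integral_comp_neg_Iic 0 (fun x ↦ H (-x) * G |x|)
    simp only [neg_neg, abs_neg, neg_zero] at h
    exact h
  rw [h1, ← integral_add hint'.integrableOn hint.integrableOn]
  refine setIntegral_congr_fun measurableSet_Ioi fun x hx ↦ ?_
  rw [abs_of_pos (mem_Ioi.1 hx)]
  ring

/-! ## Remark 3.7: integration by parts with a jump of the first derivative -/

/-- **The one-sided computation of Remark 3.7** (arXiv Rem. 18, p. 13 bottom – p. 14 top): for
`f ∈ C_c²(ℝ)` and `G ∈ C²`,
`∫₀^∞ f″(x)G(x)dx = [f′G]₀^∞ − ∫₀^∞ f′G′ = −f′(0)G(0) − [fG′]₀^∞ + ∫₀^∞ fG″ = −f′(0)G(0) + f(0)G′(0) + ∫₀^∞ f(x)G″(x)dx`.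
[cite: ConnesConsani2021, Rem. 3.7 §3 pp. 13–14] -/
theorem integral_Ioi_deriv_deriv_mul (hF : ContDiff ℝ 2 F) (hFs : HasCompactSupport F)
    (hG : ContDiff ℝ 2 G) :
    ∫ x in Ioi 0, deriv (deriv F) x * G x
      = -(deriv F 0 * G 0) + F 0 * deriv G 0 + ∫ x in Ioi 0, F x * deriv (deriv G) x := by
  have hFd : Differentiable ℝ F := hF.differentiable two_ne_zero''
  have hF'd : Differentiable ℝ (deriv F) := hF.differentiable_deriv_two
  have hGd : Differentiable ℝ G := hG.differentiable two_ne_zero''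
  have hG'd : Differentiable ℝ (deriv G) := hG.differentiable_deriv_two
  have hFc : Continuous F := hF.continuous
  have hF'c : Continuous (deriv F) := hF.continuous_deriv one_le_two'
  have hF''c : Continuous (deriv (deriv F)) := continuous_deriv_deriv hF
  have hGc : Continuous G := hG.continuous
  have hG'c : Continuous (deriv G) := hG.continuous_deriv one_le_two'
  have hG''c : Continuous (deriv (deriv G)) := continuous_deriv_deriv hG
  have hF's : HasCompactSupport (deriv F) := hFs.deriv
  have hF''s : HasCompactSupport (deriv (deriv F)) := hFs.deriv.deriv
  -- first integration by parts: `u = G`, `v = f′`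
  have step1 : ∫ x in Ioi 0, G x * deriv (deriv F) x
      = 0 - G 0 * deriv F 0 - ∫ x in Ioi 0, deriv G x * deriv F x := by
    refine integral_Ioi_mul_deriv_eq_deriv_mul (fun x _ ↦ (hGd x).hasDerivAt)
      (fun x _ ↦ (hF'd x).hasDerivAt) ?_ ?_ ?_ ?_
    · exact ((hGc.mul hF''c).integrable_of_hasCompactSupport
        (hF''s.mul_left (f := G))).integrableOn
    · exact ((hG'c.mul hF'c).integrable_of_hasCompactSupport
        (hF's.mul_left (f := deriv G))).integrableOn
    · exact ((hGc.mul hF'c).tendsto 0).mono_left nhdsWithin_le_nhds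
    · exact (hF's.mul_left (f := G)).is_zero_at_infty.mono_left atTop_le_cocompact
  -- second integration by parts: `u = G′`, `v = f`
  have step2 : ∫ x in Ioi 0, deriv G x * deriv F x
      = 0 - deriv G 0 * F 0 - ∫ x in Ioi 0, deriv (deriv G) x * F x := by
    refine integral_Ioi_mul_deriv_eq_deriv_mul (fun x _ ↦ (hG'd x).hasDerivAt)
      (fun x _ ↦ (hFd x).hasDerivAt) ?_ ?_ ?_ ?_
    · exact ((hG'c.mul hF'c).integrable_of_hasCompactSupport
        (hF's.mul_left (f := deriv G))).integrableOn
    · exact ((hG''c.mul hFc).integrable_of_hasCompactSupport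
        (hFs.mul_left (f := deriv (deriv G)))).integrableOn
    · exact ((hG'c.mul hFc).tendsto 0).mono_left nhdsWithin_le_nhds
    · exact (hFs.mul_left (f := deriv G)).is_zero_at_infty.mono_left atTop_le_cocompact
  have e1 : ∫ x in Ioi 0, deriv (deriv F) x * G x = ∫ x in Ioi 0, G x * deriv (deriv F) x :=
    integral_congr_ae (Eventually.of_forall fun x ↦ mul_comm _ _)
  have e2 : ∫ x in Ioi 0, deriv (deriv G) x * F x = ∫ x in Ioi 0, F x * deriv (deriv G) x :=
    integral_congr_ae (Eventually.of_forall fun x ↦ mul_comm _ _)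
  rw [e1, step1, step2, e2]
  ring

/-- **Connes–Consani 2021, Remark 3.7** (arXiv Rem. 18, pp. 13–14): "Let `k(x)` be an even function
on `ℝ` whose restriction to `[0, ∞)` is a smooth function, then for any `f ∈ C_c^∞(ℝ)` one has"
`∫_ℝ f″(x) k(x) dx = 2 f(0) k′(0⁺) + ∫₀^∞ (f(x) + f(−x)) k″(x) dx` — "in the global sum the boundary
terms `−f′(0)k(0)` and `f′(0)k(0)` cancel out but the boundary terms `f(0)k′(0⁺)` and `−f(0)k′(0⁻)` do
not, due to the discontinuity of the first derivative of `k` … since `k` is even, `k′(0⁻) = −k′(0⁺)`".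
Here `k(x) = G(|x|)` with `G ∈ C²(ℝ)` (so `k′(0⁺) = G′(0)`, `k″ = G″` on `(0,∞)`), `f ∈ C_c²(ℝ)`.
[cite: ConnesConsani2021, Rem. 3.7 §3 pp. 13–14] -/
theorem integral_deriv_deriv_mul_comp_abs (hF : ContDiff ℝ 2 F) (hFs : HasCompactSupport F)
    (hG : ContDiff ℝ 2 G) :
    ∫ x, deriv (deriv F) x * G |x|
      = 2 * F 0 * deriv G 0 + ∫ x in Ioi 0, (F x + F (-x)) * deriv (deriv G) x := by
  have hF''c : Continuous (deriv (deriv F)) := continuous_deriv_deriv hF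
  have hF''s : HasCompactSupport (deriv (deriv F)) := hFs.deriv.deriv
  have hG''c : Continuous (deriv (deriv G)) := continuous_deriv_deriv hG
  -- the reflected function `f(−x)` and its derivatives
  have hFn : ContDiff ℝ 2 (fun x ↦ F (-x)) := hF.comp contDiff_neg
  have hFns : HasCompactSupport (fun x ↦ F (-x)) := hFs.comp_homeomorph (Homeomorph.neg ℝ)
  have hFn1 : deriv (fun x ↦ F (-x)) = fun x ↦ -deriv F (-x) :=
    funext fun x ↦ deriv_comp_neg (f := F) x
  have hFn2 : deriv (deriv (fun x ↦ F (-x))) = fun x ↦ deriv (deriv F) (-x) := by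
    rw [hFn1]
    funext x
    rw [deriv.fun_neg, deriv_comp_neg, neg_neg]
  -- regroup `∫_ℝ f″ k = ∫₀^∞ (f″(x) + f″(−x)) G(x) dx` and split
  rw [integral_mul_comp_abs_eq_Ioi hF''c hF''s hG.continuous]
  have hi1 : IntegrableOn (fun x ↦ deriv (deriv F) x * G x) (Ioi 0) :=
    ((hF''c.mul hG.continuous).integrable_of_hasCompactSupport
      (hF''s.mul_right (f' := G))).integrableOn
  have hi2 : IntegrableOn (fun x ↦ deriv (deriv (fun x ↦ F (-x))) x * G x) (Ioi 0) :=
    (((continuous_deriv_deriv hFn).mul hG.continuous).integrable_of_hasCompactSupport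
      (hFns.deriv.deriv.mul_right (f' := G))).integrableOn
  have hi3 : IntegrableOn (fun x ↦ F x * deriv (deriv G) x) (Ioi 0) :=
    ((hF.continuous.mul hG''c).integrable_of_hasCompactSupport
      (hFs.mul_right (f' := deriv (deriv G)))).integrableOn
  have hi4 : IntegrableOn (fun x ↦ F (-x) * deriv (deriv G) x) (Ioi 0) :=
    ((hFn.continuous.mul hG''c).integrable_of_hasCompactSupport
      (hFns.mul_right (f' := deriv (deriv G)))).integrableOn
  have hsplit : ∫ x in Ioi 0, (deriv (deriv F) x + deriv (deriv F) (-x)) * G x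
      = (∫ x in Ioi 0, deriv (deriv F) x * G x)
          + ∫ x in Ioi 0, deriv (deriv (fun x ↦ F (-x))) x * G x := by
    rw [← integral_add hi1 hi2, hFn2]
    refine integral_congr_ae (Eventually.of_forall fun x ↦ ?_)
    show (deriv (deriv F) x + deriv (deriv F) (-x)) * G x
      = deriv (deriv F) x * G x + deriv (deriv F) (-x) * G x
    ring
  have hsum : (∫ x in Ioi 0, F x * deriv (deriv G) x) + ∫ x in Ioi 0, F (-x) * deriv (deriv G) x
      = ∫ x in Ioi 0, (F x + F (-x)) * deriv (deriv G) x := by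
    rw [← integral_add hi3 hi4]
    refine integral_congr_ae (Eventually.of_forall fun x ↦ ?_)
    show F x * deriv (deriv G) x + F (-x) * deriv (deriv G) x = (F x + F (-x)) * deriv (deriv G) x
    ring
  rw [hsplit, integral_Ioi_deriv_deriv_mul hF hFs hG, integral_Ioi_deriv_deriv_mul hFn hFns hG,
    hFn1, ← hsum]
  simp only [neg_zero]
  ring

/-! ## The functional `Φ₊(f) = ∫ f(x) φ(exp|x|) dx` and eq. (Qprime)/(Eprime) -/

/-- The linear form `Φ₊(f) := ∫_ℝ f(x) G(|x|) dx` of an even density `x ↦ G(|x|)`: CC's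
`D₊(f) := ∫ f(x) δ(exp|x|) dx` (§3 p. 13, `G = δ∘exp`) and `E₊(f) := ∫ f(x) ε(exp|x|) dx`
(eq. (Eprime), §5 p. 20, `G = ε∘exp`), i.e. the functionals `D(f) = ∫ f(ρ⁻¹)δ(ρ)d*ρ`,
`E(f) = ∫ f(ρ⁻¹)ε(ρ)d*ρ` in the additive variable `x = log ρ`, using `δ(ρ⁻¹) = δ(ρ)`, `ε(ρ⁻¹) = ε(ρ)`.
[cite: ConnesConsani2021, eq. (Eprime) §5 p. 20; §3 p. 13 (`D₊`)] -/
def evenFunctional (G : ℝ → ℂ) (f : ℝ → ℂ) : ℂ := ∫ x, f x * G |x|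

/-- Unfolding `evenFunctional`. [cite: ConnesConsani2021, eq. (Eprime) §5 p. 20] -/
theorem evenFunctional_apply (G f : ℝ → ℂ) : evenFunctional G f = ∫ x, f x * G |x| := rfl

/-- **Connes–Consani 2021, eq. (Qprime) (§3 p. 13, proof of Thm. 3.6) / eq. (Eprime) (§5 p. 20)**:
"`Q₊δ(exp|x|) = (−∂ₓ² + ¼)δ(exp|x|)` gives the sum of `−2δ₀` [times `δ′(1⁺) = 1`] and the even function
which coincides with `(−∂ₓ² + ¼)δ(exp x)` for `x ≥ 0`.  Equivalently, one has
`D₊(Q₊f) = −2f(0) + ∫₀^∞ (f(x) + f(−x)) Q₊δ(exp x) dx`", and "as in (Qprime) we get …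
`E₊(Q₊f) = −2ε′(1₊)f(0) + ∫₀^∞ (f(x) + f(−x))(Qε)(exp x) dx`": for `G ∈ C²(ℝ)` and `f ∈ C_c²(ℝ)`,
`Φ₊(Q₊f) = −2G′(0)f(0) + ∫₀^∞ (f(x) + f(−x)) (opQ G)(x) dx`, where `Q₊f = opQ f = −f″ + f/4`.
[cite: ConnesConsani2021, eq. (Qprime) §3 p. 13; eq. (Eprime) §5 p. 20] -/
theorem evenFunctional_opQ (hF : ContDiff ℝ 2 F) (hFs : HasCompactSupport F) (hG : ContDiff ℝ 2 G) :
    evenFunctional G (opQ F)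
      = -2 * deriv G 0 * F 0 + ∫ x in Ioi 0, (F x + F (-x)) * opQ G x := by
  have hF''c : Continuous (deriv (deriv F)) := continuous_deriv_deriv hF
  have hF''s : HasCompactSupport (deriv (deriv F)) := hFs.deriv.deriv
  have hG''c : Continuous (deriv (deriv G)) := continuous_deriv_deriv hG
  have hGa : Continuous fun x : ℝ ↦ G |x| := hG.continuous.comp continuous_abs
  have hFns : HasCompactSupport fun x : ℝ ↦ F (-x) := hFs.comp_homeomorph (Homeomorph.neg ℝ)
  have hsum_c : Continuous fun x ↦ F x + F (-x) :=
    hF.continuous.add (hF.continuous.comp continuous_neg)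
  have hsum_s : HasCompactSupport fun x ↦ F x + F (-x) := hFs.add hFns
  -- `∫ (Q₊f) k = −∫ f″ k + ¼ ∫ f k`
  have hi1 : Integrable fun x ↦ deriv (deriv F) x * G |x| :=
    (hF''c.mul hGa).integrable_of_hasCompactSupport (hF''s.mul_right (f' := fun x ↦ G |x|))
  have hi2 : Integrable fun x ↦ F x * G |x| :=
    (hF.continuous.mul hGa).integrable_of_hasCompactSupport (hFs.mul_right (f' := fun x ↦ G |x|))
  have hlhs : evenFunctional G (opQ F)
      = -(∫ x, deriv (deriv F) x * G |x|) + (1 / 4 : ℂ) * ∫ x, F x * G |x| := by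
    have e : ∀ x, opQ F x * G |x| = -(deriv (deriv F) x * G |x|) + (1 / 4 : ℂ) * (F x * G |x|) := by
      intro x
      rw [opQ_apply]
      ring
    simp_rw [evenFunctional, e]
    rw [integral_add, integral_neg, integral_const_mul]
    · exact hi1.neg
    · exact hi2.const_mul _
  -- the two pieces on `(0, ∞)`
  have hj1 : IntegrableOn (fun x ↦ (F x + F (-x)) * deriv (deriv G) x) (Ioi 0) :=
    ((hsum_c.mul hG''c).integrable_of_hasCompactSupport
      (hsum_s.mul_right (f' := deriv (deriv G)))).integrableOn
  have hj2 : IntegrableOn (fun x ↦ (F x + F (-x)) * G x) (Ioi 0) :=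
    ((hsum_c.mul hG.continuous).integrable_of_hasCompactSupport
      (hsum_s.mul_right (f' := G))).integrableOn
  have hrhs : ∫ x in Ioi 0, (F x + F (-x)) * opQ G x
      = -(∫ x in Ioi 0, (F x + F (-x)) * deriv (deriv G) x)
        + (1 / 4 : ℂ) * ∫ x in Ioi 0, (F x + F (-x)) * G x := by
    have e : ∀ x, (F x + F (-x)) * opQ G x
        = -((F x + F (-x)) * deriv (deriv G) x) + (1 / 4 : ℂ) * ((F x + F (-x)) * G x) := by
      intro x
      rw [opQ_apply]
      ring
    simp_rw [e]
    rw [integral_add, integral_neg, integral_const_mul]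
    · exact hj1.neg
    · exact hj2.const_mul _
  rw [hlhs, hrhs, integral_deriv_deriv_mul_comp_abs hF hFs hG,
    integral_mul_comp_abs_eq_Ioi hF.continuous hFs hG.continuous]
  ring

/-! ## `f = k ∗ k*`: the autocorrelation of a test function (proof of Prop. 5.5 (ii)) -/

/-- `(k ∗ k*)(v) = ∫ k(u) k̄(u − v) du` is `KernelApproximation`'s correlation at `−v`:
`weilConv k (weilReflect k) v = corrFun k k (−v)` (`corrFun ξ η v = ∫ ξ(x) η̄(x+v) dx`).
[cite: ConnesConsani2021, Prop. 5.5 (i) §5 p. 20] -/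
theorem weilConv_weilReflect_eq_corrFun (k : ℝ → ℂ) (v : ℝ) :
    weilConv k (weilReflect k) v = corrFun k k (-v) := by
  rw [weilConv_apply, corrFun]
  refine integral_congr_ae (Eventually.of_forall fun u ↦ ?_)
  show k u * weilReflect k (v - u) = k u * conj (k (u + -v))
  rw [weilReflect, show -(v - u) = u + -v by ring]

/-- If `supp k ⊆ [a, b]` then `supp (k ∗ k*) ⊆ [a − b, b − a]` ("since the length of `I` is `≤ log 2`,
the function `f(v)` vanishes outside `[−log 2, log 2]`", proof of Prop. 5.5 (ii), p. 21).
[cite: ConnesConsani2021, Prop. 5.5 (ii) §5 p. 21 (proof)] -/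
theorem tsupport_weilConv_weilReflect_subset_Icc (hk : HasCompactSupport k)
    (hks : tsupport k ⊆ Icc a b) :
    tsupport (weilConv k (weilReflect k)) ⊆ Icc (a - b) (b - a) := by
  refine (tsupport_weilConv_subset hk).trans ?_
  rw [tsupport_weilReflect]
  rintro x ⟨u, hu, v, hv, rfl⟩
  have hu' := hks hu
  have hv' : -v ∈ Icc a b := hks (by simpa using hv)
  simp only [mem_Icc] at hu' hv' ⊢
  constructor <;> linarith

/-- **Proof of Proposition 5.5 (ii), first display** (p. 21: "By applying (Eprime) to
`f(v) = ∫ ξ(x) ξ̄(x+v) dx` one obtains `⟨ξ|N_I(ξ)⟩ = −2ε′(1₊)⟨ξ|ξ⟩ + ∫₀^∞ (f(x)+f(−x))(Qε)(exp x) dx`"):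
for a test function `k` and `f = k ∗ k*` (so `f(0) = ‖k‖₂²`),
`Φ₊(Q₊f) = −2G′(0)‖k‖₂² + ∫₀^∞ (f(x)+f(−x)) (opQ G)(x) dx`.
[cite: ConnesConsani2021, Prop. 5.5 (ii) §5 p. 21 (proof)] -/
theorem evenFunctional_opQ_autocorr (hG : ContDiff ℝ 2 G) (hk : IsWeilTest k) :
    evenFunctional G (opQ (weilConv k (weilReflect k)))
      = -2 * deriv G 0 * ((∫ x, ‖k x‖ ^ 2 : ℝ) : ℂ)
        + ∫ x in Ioi 0,
            (weilConv k (weilReflect k) x + weilConv k (weilReflect k) (-x)) * opQ G x := by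
  have hF : IsWeilTest (weilConv k (weilReflect k)) := hk.weilConv hk.weilReflect
  rw [evenFunctional_opQ (contDiff_two_of_isWeilTest hF) hF.2 hG, weilConv_weilReflect_apply_zero]

/-- A set integral over the symmetric interval `[a − b, b − a]` is invariant under `v ↦ −v`. [folklore] -/
private theorem setIntegral_Icc_symm_neg {E' : Type*} [NormedAddCommGroup E'] [NormedSpace ℝ E']
    (Φ : ℝ → E') : ∫ v in Icc (a - b) (b - a), Φ (-v) = ∫ v in Icc (a - b) (b - a), Φ v := by
  rcases le_or_gt a b with hab | hab
  · have hle : a - b ≤ b - a := by linarith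
    rw [integral_Icc_eq_integral_Ioc, ← intervalIntegral.integral_of_le hle,
      integral_Icc_eq_integral_Ioc, ← intervalIntegral.integral_of_le hle,
      intervalIntegral.integral_comp_neg, show -(b - a) = a - b by ring,
      show -(a - b) = b - a by ring]
  · rw [Icc_eq_empty (by linarith), Measure.restrict_empty, integral_zero_measure,
      integral_zero_measure]

/-- "Since … `f(v)` vanishes outside `[−log 2, log 2]` … we obtain (opkf)" (p. 21): for continuous `f`
with compact support in `[a − b, b − a]` and continuous `J`,
`∫₀^∞ (f(x) + f(−x)) J(x) dx = ∫_{a−b}^{b−a} f(v) J(|v|) dv`.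
[cite: ConnesConsani2021, Prop. 5.5 (ii) §5 p. 21 (proof)] -/
theorem integral_Ioi_add_mul_eq_integral_Icc {f J : ℝ → ℂ} (hf : Continuous f)
    (hfs : HasCompactSupport f) (hfI : tsupport f ⊆ Icc (a - b) (b - a)) (hJ : Continuous J) :
    ∫ x in Ioi 0, (f x + f (-x)) * J x = ∫ v in Icc (a - b) (b - a), f v * J |v| := by
  rw [← integral_mul_comp_abs_eq_Ioi hf hfs hJ]
  refine (setIntegral_eq_integral_of_forall_compl_eq_zero fun v hv ↦ ?_).symm
  rw [image_eq_zero_of_notMem_tsupport (fun h ↦ hv (hfI h)), zero_mul]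

/-! ## The vector `ξ = k ∈ L²(I)` and the window form (opkf) -/

/-- "Let `ξ(x) := k(exp(x))`.  One has `ξ ∈ 𝓗 = L²(I)`" (proof of Thm. 6.11, p. 29): the class in
`L²([a, b], dx)` of a test function `k` (additive variable).
[cite: ConnesConsani2021, Thm. 6.11 §6.7 p. 29 (proof)] -/
def testVector (hk : IsWeilTest k) (a b : ℝ) : Lp ℂ 2 (volume.restrict (Icc a b)) :=
  ((memLp_two_of_isWeilTest hk).restrict (Icc a b)).toLp k

/-- `testVector k = k` a.e. on `I`. [cite: ConnesConsani2021, Thm. 6.11 §6.7 p. 29 (proof)] -/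
theorem coeFn_testVector (hk : IsWeilTest k) (a b : ℝ) :
    (testVector hk a b : ℝ → ℂ) =ᵐ[volume.restrict (Icc a b)] k := by
  unfold testVector
  exact MemLp.coeFn_toLp _

/-- For `supp k ⊆ I`, the zero extension of `ξ = k|_I` is `k` (a.e.).
[cite: ConnesConsani2021, Thm. 6.11 §6.7 p. 29 (proof)] -/
theorem zeroExt_testVector (hk : IsWeilTest k) (hks : tsupport k ⊆ Icc a b) :
    zeroExt (testVector hk a b) =ᵐ[volume] k := by
  filter_upwards [(ae_restrict_iff' measurableSet_Icc).1 (coeFn_testVector hk a b)] with x hx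
  by_cases hxs : x ∈ Icc a b
  · rw [zeroExt, Set.indicator_of_mem hxs, hx hxs]
  · rw [zeroExt, Set.indicator_of_notMem hxs,
      image_eq_zero_of_notMem_tsupport (fun h ↦ hxs (hks h))]

/-- `⟨ξ|ξ⟩ = ‖k‖₂²` for `ξ = k|_I`, `supp k ⊆ I` ("`f(0) = (ξ^* ∗ ξ)(0) = ‖ξ‖²`", p. 13).
[cite: ConnesConsani2021, Thm. 3.6 §3 p. 13 (proof)] -/
theorem inner_testVector_self (hk : IsWeilTest k) (hks : tsupport k ⊆ Icc a b) :
    ⟪testVector hk a b, testVector hk a b⟫_ℂ = ((∫ x, ‖k x‖ ^ 2 : ℝ) : ℂ) := by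
  rw [L2.inner_def]
  have h1 : ∫ x in Icc a b, ⟪(testVector hk a b : ℝ → ℂ) x, (testVector hk a b : ℝ → ℂ) x⟫_ℂ
      = ∫ x in Icc a b, ((‖k x‖ ^ 2 : ℝ) : ℂ) := by
    refine integral_congr_ae ?_
    filter_upwards [coeFn_testVector hk a b] with x hx
    rw [hx, RCLike.inner_apply', Complex.conj_mul', Complex.ofReal_pow]
  rw [h1, setIntegral_eq_integral_of_forall_compl_eq_zero fun x hx ↦ ?_, integral_complex_ofReal]
  rw [image_eq_zero_of_notMem_tsupport (fun h ↦ hx (hks h)), norm_zero]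
  simp

/-- `‖ξ‖² = ‖k‖₂²` for `ξ = k|_I`. [cite: ConnesConsani2021, Thm. 3.6 §3 p. 13 (proof)] -/
theorem norm_testVector_sq (hk : IsWeilTest k) (hks : tsupport k ⊆ Icc a b) :
    ‖testVector hk a b‖ ^ 2 = ∫ x, ‖k x‖ ^ 2 := by
  rw [← inner_self_eq_norm_sq (𝕜 := ℂ), inner_testVector_self hk hks]
  simp

/-- `corrFun` only depends on the a.e. classes of its arguments. [folklore] -/
private theorem corrFun_congr_ae' {ξ₁ ξ₂ η₁ η₂ : ℝ → ℂ} (h₁ : ξ₁ =ᵐ[volume] ξ₂)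
    (h₂ : η₁ =ᵐ[volume] η₂) (v : ℝ) : corrFun ξ₁ η₁ v = corrFun ξ₂ η₂ v := by
  refine integral_congr_ae ?_
  have h₂' : (fun x ↦ η₁ (x + v)) =ᵐ[volume] fun x ↦ η₂ (x + v) :=
    (measurePreserving_add_right volume v).quasiMeasurePreserving.ae_eq_comp h₂
  filter_upwards [h₁, h₂'] with x hx1 hx2
  simp only [hx1, hx2]

/-- The window form (opkf) of `ξ = k|_I` is the kernel integral of the correlation of `k`:
`windowForm a b κ ξ ξ = ∫_{a−b}^{b−a} (∫ k(x) k̄(x+v) dx) κ(v) dv`.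
[cite: ConnesConsani2021, Prop. 5.5 (ii) §5 p. 20] -/
theorem windowForm_testVector (hk : IsWeilTest k) (hks : tsupport k ⊆ Icc a b) (κ : ℝ → ℂ) :
    windowForm a b κ (testVector hk a b) (testVector hk a b)
      = ∫ v in Icc (a - b) (b - a), corrFun k k v * κ v := by
  simp only [windowForm, kernelForm]
  refine setIntegral_congr_fun measurableSet_Icc fun v _ ↦ ?_
  simp only [corrFun_congr_ae' (zeroExt_testVector hk hks) (zeroExt_testVector hk hks) v]

/-- **Proof of Proposition 5.5 (ii), second step** ("… and thus we obtain (opkf)", p. 21): for a test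
function `k` with `supp k ⊆ I = [a, b]`, `ξ = k|_I ∈ L²(I)` and `f = k ∗ k*`,
`Φ₊(Q₊f) = −2G′(0)‖ξ‖² + ∫_{a−b}^{b−a} ∫ ξ(x) ξ̄(x+v) (opQ G)(|v|) dx dv`, the double integral being the
window form (opkf) of the even kernel `v ↦ (opQ G)(|v|)` (CC: `(Qε)(exp|v|)`, `I = [−½log 2, ½log 2]`,
`[a − b, b − a] = [−log 2, log 2]`). [cite: ConnesConsani2021, Prop. 5.5 (ii) §5 pp. 20–21] -/
theorem evenFunctional_opQ_autocorr_eq_windowForm (hG : ContDiff ℝ 2 G) (hk : IsWeilTest k)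
    (hks : tsupport k ⊆ Icc a b) :
    evenFunctional G (opQ (weilConv k (weilReflect k)))
      = -2 * deriv G 0 * ((‖testVector hk a b‖ ^ 2 : ℝ) : ℂ)
        + windowForm a b (fun v ↦ opQ G |v|) (testVector hk a b) (testVector hk a b) := by
  have hF : IsWeilTest (weilConv k (weilReflect k)) := hk.weilConv hk.weilReflect
  rw [evenFunctional_opQ_autocorr hG hk, ← norm_testVector_sq hk hks,
    integral_Ioi_add_mul_eq_integral_Icc hF.1.continuous hF.2
      (tsupport_weilConv_weilReflect_subset_Icc hk.2 hks) (continuous_opQ hG),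
    windowForm_testVector hk hks]
  congr 1
  rw [← setIntegral_Icc_symm_neg (fun v ↦ corrFun k k v * opQ G |v|)]
  refine setIntegral_congr_fun measurableSet_Icc fun v _ ↦ ?_
  simp only [weilConv_weilReflect_eq_corrFun, abs_neg]

/-! ## Proposition 5.5: `N_I = −2ε′(1₊)(1 − 𝐊_I)` -/

/-- CC's kernel `ϖ(x) := (Qε)(exp|x|)/(2ε′(1₊))` (§6.3 p. 24; the kernel of (opkf), Prop. 5.5 (ii)
p. 20), for a general smooth branch `G` in place of `ε∘exp`: `ϖ_G(v) = (opQ G)(|v|)/(2G′(0))`.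
[cite: ConnesConsani2021, §6.3 p. 24 (definition of `ϖ`); Prop. 5.5 (ii) §5 p. 20] -/
def varpi (G : ℝ → ℂ) (v : ℝ) : ℂ := opQ G |v| / (2 * deriv G 0)

/-- Unfolding `varpi`. [cite: ConnesConsani2021, §6.3 p. 24] -/
theorem varpi_apply (G : ℝ → ℂ) (v : ℝ) : varpi G v = opQ G |v| / (2 * deriv G 0) := rfl

/-- `ϖ_G` is even. [cite: ConnesConsani2021, §6.3 p. 24] -/
theorem varpi_neg (G : ℝ → ℂ) (v : ℝ) : varpi G (-v) = varpi G v := by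
  simp [varpi, abs_neg]

/-- `ϖ_G` is continuous for `G ∈ C²`. [cite: ConnesConsani2021, §6.3 p. 24] -/
theorem continuous_varpi (hG : ContDiff ℝ 2 G) : Continuous (varpi G) := by
  show Continuous fun v ↦ opQ G |v| / (2 * deriv G 0)
  exact ((continuous_opQ hG).comp' continuous_abs).div_const _

/-- `ϖ_G ∈ L¹[a − b, b − a]` (it is continuous), so that `windowOp ϖ_G` is defined.
[cite: ConnesConsani2021, §6.3 p. 24] -/
theorem integrableOn_varpi (hG : ContDiff ℝ 2 G) (a b : ℝ) :
    IntegrableOn (varpi G) (Icc (a - b) (b - a)) :=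
  (continuous_varpi hG).continuousOn.integrableOn_compact isCompact_Icc

/-- CC's operator `N_I := −2ε′(1₊)(1 − 𝐊_I)` on `𝓗 = L²(I, dx)` (Prop. 5.5 (ii), p. 20), for a
general smooth branch `G` in place of `ε∘exp` (`G′(0)` in place of `ε′(1₊)`), with `𝐊_I = windowOp ϖ_G`
the bounded operator of (opkf) (`KernelApproximation.windowOp`).
[cite: ConnesConsani2021, Prop. 5.5 (ii) §5 p. 20] -/
def opN (hG : ContDiff ℝ 2 G) (a b : ℝ) :
    Lp ℂ 2 (volume.restrict (Icc a b)) →L[ℂ] Lp ℂ 2 (volume.restrict (Icc a b)) :=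
  (-(2 * deriv G 0)) • (1 - windowOp a b (integrableOn_varpi hG a b))

/-- Unfolding `opN`: `N = −2G′(0)(1 − windowOp ϖ_G)`.
[cite: ConnesConsani2021, Prop. 5.5 (ii) §5 p. 20] -/
theorem opN_apply (hG : ContDiff ℝ 2 G) (ξ : Lp ℂ 2 (volume.restrict (Icc a b))) :
    opN hG a b ξ = (-(2 * deriv G 0)) • (ξ - windowOp a b (integrableOn_varpi hG a b) ξ) := by
  simp [opN]

/-- The window form is homogeneous in the kernel. [folklore] -/
private theorem windowForm_const_mul (c : ℂ) (κ : ℝ → ℂ)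
    (ξ η : Lp ℂ 2 (volume.restrict (Icc a b))) :
    windowForm a b (fun v ↦ c * κ v) ξ η = c * windowForm a b κ ξ η := by
  simp only [windowForm, kernelForm, ← integral_const_mul]
  refine integral_congr_ae (Eventually.of_forall fun v ↦ ?_)
  simp only
  ring

/-- **Connes–Consani 2021, Proposition 5.5, as used in the proof of Theorem 6.11** (Prop. 32 (i)–(ii)
p. 20, proof p. 21; Thm. 6.11 proof p. 29: "`E∘Q(k ∗ k*) = E₊(Q₊(ξ ∗ ξ*)) = ⟨ξ|N_I(ξ)⟩`"), vector form:
for `G ∈ C²(ℝ)` with `G′(0) ≠ 0`, a test function `k` with `supp k ⊆ I = [a, b]` and `ξ = k|_I`,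
`Φ₊(Q₊(k ∗ k*)) = ⟨ξ | (−2G′(0))·(ξ − 𝐊 ξ)⟩` with `𝐊 = windowOp ϖ_G`, i.e.
`⟨ξ|𝐊 ξ⟩ = (2G′(0))⁻¹ ∫_{a−b}^{b−a} ∫ ξ(x) ξ̄(x+v) (opQ G)(|v|) dx dv` — the shape
`⟨ξ, (−2e′)•(ξ − K ξ)⟩` of `RankOnePositivity.re_inner_scaled_le_of_rankOne_decomposition`.
(CC: `G = ε∘exp`, `G′(0) = ε′(1₊) ≃ 22.9965`, `I = [−½log 2, ½log 2]`.)
[cite: ConnesConsani2021, Prop. 5.5 §5 pp. 20–21; Thm. 6.11 §6.7 p. 29 (proof)] -/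
theorem evenFunctional_opQ_autocorr_eq_inner (hG : ContDiff ℝ 2 G) (hG0 : deriv G 0 ≠ 0)
    (hk : IsWeilTest k) (hks : tsupport k ⊆ Icc a b) :
    evenFunctional G (opQ (weilConv k (weilReflect k)))
      = ⟪testVector hk a b, (-(2 * deriv G 0)) • (testVector hk a b
          - windowOp a b (integrableOn_varpi hG a b) (testVector hk a b))⟫_ℂ := by
  rw [evenFunctional_opQ_autocorr_eq_windowForm hG hk hks, inner_smul_right, inner_sub_right,
    inner_windowOp, inner_testVector_self hk hks, ← norm_testVector_sq hk hks]
  have hker : (fun v ↦ opQ G |v|) = fun v ↦ (2 * deriv G 0) * varpi G v := by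
    funext v
    rw [varpi, mul_div_cancel₀ _ (mul_ne_zero two_ne_zero hG0)]
  rw [hker, windowForm_const_mul]
  ring

/-- **Connes–Consani 2021, Proposition 5.5 (i)+(ii)** in operator form: with `N = opN`
(`= −2G′(0)(1 − windowOp ϖ_G)`, CC's `N_I = −2ε′(1₊)(1 − 𝐊_I)`), for every test function `k` with
`supp k ⊆ I` and `ξ = k|_I`, `⟨ξ | N ξ⟩ = Φ₊(Q₊(k ∗ k*))` ("the following equality defines a bounded
operator `N_I` … `⟨ξ|N_I(ξ)⟩ = E₊(Q₊ f)`, `f = ξ^* ∗ ξ`"; such `ξ` are the vectors used on p. 29).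
[cite: ConnesConsani2021, Prop. 5.5 §5 pp. 20–21] -/
theorem evenFunctional_opQ_autocorr_eq_inner_opN (hG : ContDiff ℝ 2 G) (hG0 : deriv G 0 ≠ 0)
    (hk : IsWeilTest k) (hks : tsupport k ⊆ Icc a b) :
    ⟪testVector hk a b, opN hG a b (testVector hk a b)⟫_ℂ
      = evenFunctional G (opQ (weilConv k (weilReflect k))) := by
  rw [opN_apply, evenFunctional_opQ_autocorr_eq_inner hG hG0 hk hks]

/-- **Theorem 3.6's shape** (Thm. 17, p. 13: "`D∘Q(ξ ∗ ξ*) = ⟨ξ|(−2 + K_I)ξ⟩ = −2‖ξ‖² + ⟨ξ|K_I ξ⟩`",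
where `⟨ξ|K_I(ξ)⟩ := ∫_1^∞ ((ξ^** ∗ ξ)(ρ) + (ξ^** ∗ ξ)(ρ⁻¹)) Qδ(ρ) d*ρ`): when the smooth branch has
`G′(0) = 1` (for `δ`: `δ(exp|x|) = δ(1) + |x| + O(x²)`, p. 13), for every test function `k` with
`supp k ⊆ I` and `ξ = k|_I`, `Φ₊(Q₊(k ∗ k*)) = −2‖ξ‖² + ⟨ξ | windowOp((opQ G)∘|·|) ξ⟩`.  The function
`δ` itself (§2, via `Si`) is not typed here. [cite: ConnesConsani2021, Thm. 3.6 §3 p. 13] -/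
theorem evenFunctional_opQ_autocorr_eq_inner_of_deriv_eq_one (hG : ContDiff ℝ 2 G)
    (hG1 : deriv G 0 = 1) (hk : IsWeilTest k) (hks : tsupport k ⊆ Icc a b)
    (hκ : IntegrableOn (fun v ↦ opQ G |v|) (Icc (a - b) (b - a))) :
    evenFunctional G (opQ (weilConv k (weilReflect k)))
      = -2 * ((‖testVector hk a b‖ ^ 2 : ℝ) : ℂ)
        + ⟪testVector hk a b, windowOp a b hκ (testVector hk a b)⟫_ℂ := by
  rw [evenFunctional_opQ_autocorr_eq_windowForm hG hk hks, inner_windowOp, hG1, mul_one]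

/-! ## `η₀` and `⟨η₀|ξ⟩ = |I|^{-1/2} k̂(0)` (proof of Theorem 6.11, p. 29) -/

/-- CC's unit vector `η₀ ∈ 𝓗 = L²(I, dx)`: "the constant function normalized to be of norm `1`"
(§6.7 p. 28; Fact 6.5 p. 25), i.e. the class of the constant `(b − a)^{-1/2}` on `I = [a, b]`
(`(log 2)^{-1/2}` for CC's `I = [−½ log 2, ½ log 2]`). [cite: ConnesConsani2021, §6.7 p. 28] -/
def constVector (a b : ℝ) : Lp ℂ 2 (volume.restrict (Icc a b)) :=
  (memLp_const (((Real.sqrt (b - a))⁻¹ : ℝ) : ℂ)).toLp _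

/-- `η₀ = (b − a)^{-1/2}` a.e. on `I`. [cite: ConnesConsani2021, §6.7 p. 28] -/
theorem coeFn_constVector (a b : ℝ) :
    (constVector a b : ℝ → ℂ) =ᵐ[volume.restrict (Icc a b)]
      fun _ ↦ (((Real.sqrt (b - a))⁻¹ : ℝ) : ℂ) := by
  unfold constVector
  exact MemLp.coeFn_toLp _

/-- `‖η₀‖ = 1` ("normalized to be of norm `1`", p. 28). [cite: ConnesConsani2021, §6.7 p. 28] -/
theorem norm_constVector (hab : a < b) : ‖constVector a b‖ = 1 := by
  have hba : 0 < b - a := sub_pos.2 hab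
  have h2 : ‖constVector a b‖ ^ 2 = 1 := by
    rw [← inner_self_eq_norm_sq (𝕜 := ℂ), L2.inner_def]
    have h1 : ∫ x in Icc a b, ⟪(constVector a b : ℝ → ℂ) x, (constVector a b : ℝ → ℂ) x⟫_ℂ
        = ∫ _ in Icc a b, (((b - a)⁻¹ : ℝ) : ℂ) := by
      refine integral_congr_ae ?_
      filter_upwards [coeFn_constVector a b] with x hx
      rw [hx, RCLike.inner_apply', Complex.conj_ofReal, ← Complex.ofReal_mul, ← mul_inv,
        Real.mul_self_sqrt hba.le]
    rw [h1, setIntegral_const, Real.volume_real_Icc_of_le hab.le, Complex.real_smul,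
      ← Complex.ofReal_mul, mul_inv_cancel₀ hba.ne']
    simp
  rw [← Real.sqrt_sq (norm_nonneg _), h2, Real.sqrt_one]

/-- `k̂(0) = ∫ k` in the tree's additive normalisation (`mulFourier k 0 = ∫ k(t) dt`, CC's
`k̂(0) = ∫₀^∞ k(u) d*u`, p. 29). [cite: ConnesConsani2021, Thm. 6.11 §6.7 p. 29 (proof)] -/
theorem mulFourier_zero_eq_integral (k : ℝ → ℂ) : mulFourier k 0 = ∫ t, k t := by
  rw [mulFourier_zero, weilMellin]
  refine integral_congr_ae (Eventually.of_forall fun t ↦ ?_)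
  simp

/-- **"using `⟨η₀|ξ⟩ = (log 2)^{-1/2} ξ̂(0) = (log 2)^{-1/2} k̂(0)`"** (proof of Thm. 6.11, p. 29): for
`ξ = k|_I`, `supp k ⊆ I = [a, b]`, `⟨η₀|ξ⟩ = (b − a)^{-1/2} k̂(0)`.
[cite: ConnesConsani2021, Thm. 6.11 §6.7 p. 29 (proof)] -/
theorem inner_constVector_testVector (hk : IsWeilTest k) (hks : tsupport k ⊆ Icc a b) :
    ⟪constVector a b, testVector hk a b⟫_ℂ
      = (((Real.sqrt (b - a))⁻¹ : ℝ) : ℂ) * mulFourier k 0 := by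
  rw [L2.inner_def]
  have h1 : ∫ x in Icc a b, ⟪(constVector a b : ℝ → ℂ) x, (testVector hk a b : ℝ → ℂ) x⟫_ℂ
      = ∫ x in Icc a b, (((Real.sqrt (b - a))⁻¹ : ℝ) : ℂ) * k x := by
    refine integral_congr_ae ?_
    filter_upwards [coeFn_constVector a b, coeFn_testVector hk a b] with x hx hx'
    rw [hx, hx', RCLike.inner_apply', Complex.conj_ofReal]
  rw [h1, integral_const_mul, setIntegral_eq_integral_of_forall_compl_eq_zero fun x hx ↦ ?_,
    mulFourier_zero_eq_integral]
  exact image_eq_zero_of_notMem_tsupport fun h ↦ hx (hks h)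

/-- `|⟨η₀|ξ⟩|² = (b − a)⁻¹ |k̂(0)|²` ("`γ|⟨η₀|ξ⟩|² = (γ/log 2)|k̂(0)|²`", p. 29).
[cite: ConnesConsani2021, Thm. 6.11 §6.7 p. 29 (proof)] -/
theorem norm_inner_constVector_testVector_sq (hab : a < b) (hk : IsWeilTest k)
    (hks : tsupport k ⊆ Icc a b) :
    ‖⟪constVector a b, testVector hk a b⟫_ℂ‖ ^ 2 = (b - a)⁻¹ * ‖mulFourier k 0‖ ^ 2 := by
  have hba : 0 < b - a := sub_pos.2 hab
  rw [inner_constVector_testVector hk hks, norm_mul, Complex.norm_real, Real.norm_eq_abs,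
    abs_of_pos (inv_pos.2 (Real.sqrt_pos.2 hba)), mul_pow, inv_pow, Real.sq_sqrt hba.le]

/-! ## The chain of p. 29: `E∘Q(k ∗ k*) = ⟨ξ|N_I ξ⟩ ≤ γ|⟨η₀|ξ⟩|² = (γ/log 2)|k̂(0)|²` -/

/-- **The p. 29 chain of the proof of Theorem 6.11, assembled** from Prop. 5.5
(`evenFunctional_opQ_autocorr_eq_inner`), Lemma 6.10's deduction
(`RankOnePositivity.re_inner_scaled_le_of_rankOne_decomposition`) and `⟨η₀|ξ⟩ = (b − a)^{-1/2} k̂(0)`: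
let `G ∈ C²` with `G′(0) = e′ > 0` (CC: `ε′(1₊) ≃ 22.9965`), `𝐊 = windowOp ϖ_G` on `L²(I)`,
`I = [a, b]`, and suppose, as in §6.7, `T = λ_max|η⟩⟨η| + R` with `R ≤ λ₂ P_η` (`‖η‖ = 1`,
`λ_max ≥ 1 ≥ λ₂`), `‖𝐊 − T‖ ≤ ε₁`, `a₀ ≥ 0` with `ε₁ ≤ ε₂ = rankOneGap a₀ (λ_max − 1) (1 − λ₂) |⟨η|η₀⟩|`
(`η₀` the normalized constant).  Then for every test function `k` with `supp k ⊆ I`,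
`Re E₊(Q₊(k ∗ k*)) ≤ (2a₀e′/(b − a)) |k̂(0)|²` — "`E(f) = E∘Q(k ∗ k*) = ⟨ξ|N_I(ξ)⟩ ≤ γ|⟨η₀|ξ⟩|²
= (γ/log 2)|k̂(0)|²`", `γ = 2aε′(1₊)`; with `k̂(0) = −2ĝ(0)` (`thm611_constant_eq`) this is the
constant `c = 4γ/log 2` of Theorem 6.11.  All spectral inputs are hypotheses (in print they are the
floating-point data of §6); the identification `E(f) = Tr(ϑ(f)𝐒) − W_∞(f)` (Thm. 4.7) and
`G = ε∘exp` are not typed.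
[cite: ConnesConsani2021, Thm. 6.11 §6.7 p. 29 (proof); Lemma 6.10 p. 28] -/
theorem re_evenFunctional_opQ_autocorr_le
    {T R : Lp ℂ 2 (volume.restrict (Icc a b)) →L[ℂ] Lp ℂ 2 (volume.restrict (Icc a b))}
    {η : Lp ℂ 2 (volume.restrict (Icc a b))} {lmax l₂ a₀ ε₁ e' : ℝ}
    (hG : ContDiff ℝ 2 G) (hGe : deriv G 0 = e') (he' : 0 < e') (hab : a < b)
    (hk : IsWeilTest k) (hks : tsupport k ⊆ Icc a b)
    (hη : ‖η‖ = 1) (hlmax : 1 ≤ lmax) (hl₂ : l₂ ≤ 1) (ha₀ : 0 ≤ a₀)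
    (hT : ∀ ξ, T ξ = ((lmax : ℝ) : ℂ) • ⟪η, ξ⟫_ℂ • η + R ξ)
    (hR : ∀ ξ, RCLike.re ⟪ξ, R ξ⟫_ℂ ≤ l₂ * ‖(ℂ ∙ η)ᗮ.starProjection ξ‖ ^ 2)
    (hKT : ‖windowOp a b (integrableOn_varpi hG a b) - T‖ ≤ ε₁)
    (hε : ε₁ ≤ rankOneGap a₀ (lmax - 1) (1 - l₂) ‖⟪η, constVector a b⟫_ℂ‖) :
    (evenFunctional G (opQ (weilConv k (weilReflect k)))).re
      ≤ 2 * a₀ * e' / (b - a) * ‖mulFourier k 0‖ ^ 2 := by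
  have h := re_inner_scaled_le_of_rankOne_decomposition (𝕜 := ℂ) hη (norm_constVector hab) hlmax
    hl₂ ha₀ hT hR hKT hε he'.le (testVector hk a b)
  rw [norm_inner_constVector_testVector_sq hab hk hks] at h
  have hG0 : deriv G 0 ≠ 0 := by
    rw [hGe]
    exact_mod_cast he'.ne'
  rw [evenFunctional_opQ_autocorr_eq_inner hG hG0 hk hks, hGe]
  have e : (-(2 * (e' : ℂ))) = ((-(2 * e') : ℝ) : ℂ) := by push_cast; ring
  rw [e, ← RCLike.re_to_complex]
  calc RCLike.re ⟪testVector hk a b, ((-(2 * e') : ℝ) : ℂ) • (testVector hk a b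
          - windowOp a b (integrableOn_varpi hG a b) (testVector hk a b))⟫_ℂ
        ≤ 2 * a₀ * e' * ((b - a)⁻¹ * ‖mulFourier k 0‖ ^ 2) := h
    _ = 2 * a₀ * e' / (b - a) * ‖mulFourier k 0‖ ^ 2 := by ring

end Literature.NumberTheory.ConnesConsani2021

end
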